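import Mathlib.Analysis.SpecialFunctions.Pow.Real
import HarnessLib

/-!
# Route `SwapVirialDeficit` (YangMills): the `ψ₀ = b^{−σ}` CUT ARITHMETIC — from a `ψ₀`-FAMILY of bulk∕rest decompositions with `ψ₀`-dependent
# constants to ONE per-`(L,b)` bulk∕rest datum with power rates (the shape of `h₀ ∕ h₁` in ✓`swapGluedStiffness_of_bulk_rest` ∕ ✓`swapMeanActionGap_of_bulk_rest`, rate-general)

LEAD ym-line-sfw-p2 g97 (cell ym-idea-1, free hands; `--supports stmt-QuantumFields-24197`; generic, model-free).  Architecture ruling 2026-08-31T17:34Z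
(answer to fcl-p3 g47's FORMAT CATCH): the main constant `Main` of a sector is the FULL Morse–Bott integral (tip included, `b`-independent); the cone tip
is cut at ONE `b`-dependent angle `ψ₀ = b^{−σ}`; the bulk `{ψ ≥ ψ₀}` is run by the `√b` fibred Laplace lemma whose constant degrades like `ψ₀^{−k}`
(coercivity `λ(ψ₀) ≍ ψ₀²`), the bottom-measure deficit `Main − Main_bulk(ψ₀) ≤ P·ψ₀^κ·Main` and the tip share `R(ψ₀) ≤ P·(ψ₀^κ + b^{−κ′})·Main` are
`ψ₀`-uniform.  This file does the arithmetic once, for any `Z, Main > 0`, `b ≥ 1`, `P ≥ 0`: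

★★ `bulk_rest_of_cut_family` — if for every `ψ₀ ∈ (0, 1]` there are `Ib, R, Mb` with `Ib ≤ Z ≤ Ib + R`, `|Ib − Mb| ≤ P·ψ₀^{−k}·b^{−1/2}·Mb`,
`0 ≤ Mb ≤ Main`, `Main − Mb ≤ P·ψ₀^κ·Main`, `R ≤ P·(ψ₀^κ + b^{−κ′})·Main`, and `k·σ ≤ 1/4`, `0 < σ ≤ 1`… then (taking `ψ₀ = b^{−σ}`) there are `Ib, R` with
`Ib ≤ Z ≤ Ib + R`, `|Ib − Main| ≤ (2P + P²)·b^{−θ₂}·Main`, `R ≤ 2P·b^{−θ₃}·Main`, `θ₂ = min (1/4) (σκ)`, `θ₃ = min (σκ) κ′` — so the assembler's stubs may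
carry `ψ₀` as a free parameter with explicit `ψ₀`-dependence and never choose `σ` inside a model file.

HONEST LABEL: elementary real arithmetic (theorems only, 0 `def`, 0 `sorry`, standard axioms); nothing model-side; ⟨24197⟩ ∕ ⟨24194⟩ OPEN; ⟨24196⟩ proved
(p829544); own crux ⟨22884⟩ OPEN (blocked-on ⟨19935⟩); the Yang–Mills mass gap is NOT proved; no summit is proved by a line.  References: [folklore].
-/

set_option autoImplicit false

noncomputable section

namespace Summit.QuantumFields.YangMills.Theorems.QuantitativeLaplace

/-- ★★ **THE `ψ₀ = b^{−σ}` CUT ARITHMETIC.**  `Z` = the sector integral, `Main > 0` = `(2π/b)^e·𝔐_full`, `b ≥ 1`, `P ≥ 0` (a polynomial `K·L^q` in the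
application), exponents `k ≥ 0` (bulk-constant degradation), `κ > 0` (bottom-measure ∕ tip share), `κ′ > 0` (tip Laplace rate), `0 < σ` with `k·σ ≤ 1/4`.
(Positivity of `k, κ, κ′` is not even needed for the arithmetic.)  Hypothesis: for every cut `ψ₀ ∈ (0,1]` a bulk∕rest decomposition `Ib ≤ Z ≤ Ib + R` with bulk main term `0 ≤ Mb ≤ Main`,
`|Ib − Mb| ≤ P·ψ₀^{−k}·b^{−1/2}·Mb`, `Main − Mb ≤ P·ψ₀^κ·Main`, `R ≤ P·(ψ₀^κ + b^{−κ′})·Main`.  Conclusion: a decomposition with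
`|Ib − Main| ≤ 2P·b^{−min(1/4, σκ)}·Main` and `R ≤ 2P·b^{−min(σκ, κ′)}·Main`. [folklore] -/
theorem bulk_rest_of_cut_family {Z Main b P k κ κ' σ : ℝ} (hb : 1 ≤ b) (hP : 0 ≤ P) (hMain : 0 < Main)
    (hσ : 0 < σ) (hkσ : k * σ ≤ 1 / 4)
    (h : ∀ ψ₀ : ℝ, 0 < ψ₀ → ψ₀ ≤ 1 → ∃ Ib R Mb : ℝ, Ib ≤ Z ∧ Z ≤ Ib + R ∧ 0 ≤ Mb ∧ Mb ≤ Main ∧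
      |Ib - Mb| ≤ P * ψ₀ ^ (-k) * b ^ (-(1 / 2 : ℝ)) * Mb ∧ Main - Mb ≤ P * ψ₀ ^ κ * Main ∧ R ≤ P * (ψ₀ ^ κ + b ^ (-κ')) * Main) :
    ∃ Ib R : ℝ, Ib ≤ Z ∧ Z ≤ Ib + R ∧ |Ib - Main| ≤ (2 * P) * b ^ (-(min (1 / 4) (σ * κ))) * Main ∧
      R ≤ (2 * P) * b ^ (-(min (σ * κ) κ')) * Main := by
  have hb0 : 0 < b := by linarith
  -- the cut `ψ₀ = b^{−σ} ∈ (0, 1]`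
  set ψ₀ : ℝ := b ^ (-σ) with hψ₀
  have hψ0 : 0 < ψ₀ := Real.rpow_pos_of_pos hb0 _
  have hψ1 : ψ₀ ≤ 1 := by
    rw [hψ₀]; exact Real.rpow_le_one_of_one_le_of_nonpos hb (by linarith)
  obtain ⟨Ib, R, Mb, hIZ, hZI, hMb0, hMbM, hbulk, hdef, hR⟩ := h ψ₀ hψ0 hψ1
  refine ⟨Ib, R, hIZ, hZI, ?_, ?_⟩
  · -- `|Ib − Main| ≤ |Ib − Mb| + (Main − Mb)`
    have e1 : ψ₀ ^ (-k) * b ^ (-(1 / 2 : ℝ)) = b ^ (-(1 / 2 - k * σ)) := by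
      rw [hψ₀, ← Real.rpow_mul hb0.le, ← Real.rpow_add hb0]; congr 1; ring
    have e2 : ψ₀ ^ κ = b ^ (-(σ * κ)) := by rw [hψ₀, ← Real.rpow_mul hb0.le]; congr 1; ring
    have hm1 : min (1 / 4 : ℝ) (σ * κ) ≤ 1 / 2 - k * σ := (min_le_left _ _).trans (by linarith)
    have hm2 : min (1 / 4 : ℝ) (σ * κ) ≤ σ * κ := min_le_right _ _
    have h1 : b ^ (-(1 / 2 - k * σ)) ≤ b ^ (-(min (1 / 4) (σ * κ))) := Real.rpow_le_rpow_of_exponent_le hb (by linarith)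
    have h2 : b ^ (-(σ * κ)) ≤ b ^ (-(min (1 / 4) (σ * κ))) := Real.rpow_le_rpow_of_exponent_le hb (by linarith)
    have hbt : 0 ≤ b ^ (-(min (1 / 4) (σ * κ))) := Real.rpow_nonneg hb0.le _
    have hA : |Ib - Mb| ≤ P * b ^ (-(min (1 / 4) (σ * κ))) * Main := by
      calc |Ib - Mb| ≤ P * ψ₀ ^ (-k) * b ^ (-(1 / 2 : ℝ)) * Mb := hbulk
        _ = P * b ^ (-(1 / 2 - k * σ)) * Mb := by rw [mul_assoc P, e1]
        _ ≤ P * b ^ (-(min (1 / 4) (σ * κ))) * Main :=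
            mul_le_mul (mul_le_mul_of_nonneg_left h1 hP) hMbM hMb0 (mul_nonneg hP hbt)
    have hB : Main - Mb ≤ P * b ^ (-(min (1 / 4) (σ * κ))) * Main := by
      calc Main - Mb ≤ P * ψ₀ ^ κ * Main := hdef
        _ = P * b ^ (-(σ * κ)) * Main := by rw [e2]
        _ ≤ P * b ^ (-(min (1 / 4) (σ * κ))) * Main :=
            mul_le_mul_of_nonneg_right (mul_le_mul_of_nonneg_left h2 hP) hMain.le
    have htri : |Ib - Main| ≤ |Ib - Mb| + (Main - Mb) := by
      have h3 := abs_sub_le Ib Mb Main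
      rw [abs_of_nonpos (by linarith : Mb - Main ≤ 0)] at h3
      linarith
    calc |Ib - Main| ≤ |Ib - Mb| + (Main - Mb) := htri
      _ ≤ P * b ^ (-(min (1 / 4) (σ * κ))) * Main + P * b ^ (-(min (1 / 4) (σ * κ))) * Main := add_le_add hA hB
      _ = (2 * P) * b ^ (-(min (1 / 4) (σ * κ))) * Main := by ring
  · have e2 : ψ₀ ^ κ = b ^ (-(σ * κ)) := by rw [hψ₀, ← Real.rpow_mul hb0.le]; congr 1; ring
    have hm3 : min (σ * κ) κ' ≤ σ * κ := min_le_left _ _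
    have hm4 : min (σ * κ) κ' ≤ κ' := min_le_right _ _
    have h2 : b ^ (-(σ * κ)) ≤ b ^ (-(min (σ * κ) κ')) := Real.rpow_le_rpow_of_exponent_le hb (by linarith)
    have h3 : b ^ (-κ') ≤ b ^ (-(min (σ * κ) κ')) := Real.rpow_le_rpow_of_exponent_le hb (by linarith)
    calc R ≤ P * (ψ₀ ^ κ + b ^ (-κ')) * Main := hR
      _ = P * (b ^ (-(σ * κ)) + b ^ (-κ')) * Main := by rw [e2]
      _ ≤ P * (b ^ (-(min (σ * κ) κ')) + b ^ (-(min (σ * κ) κ'))) * Main :=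
          mul_le_mul_of_nonneg_right (mul_le_mul_of_nonneg_left (add_le_add h2 h3) hP) hMain.le
      _ = (2 * P) * b ^ (-(min (σ * κ) κ')) * Main := by ring

/-- ★ **The rates are admissible**: `0 < min (1/4) (σκ) ≤ 1` and `0 < min (σκ) κ′` — the `hθ₂ ∕ hθ₃` side conditions of the rate-general bulk∕rest
consumers. [folklore] -/
theorem cut_family_rates {σ κ κ' : ℝ} (hσ : 0 < σ) (hκ : 0 < κ) (hκ' : 0 < κ') :
    0 < min (1 / 4 : ℝ) (σ * κ) ∧ min (1 / 4 : ℝ) (σ * κ) ≤ 1 ∧ 0 < min (σ * κ) κ' :=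
  ⟨lt_min (by norm_num) (mul_pos hσ hκ), (min_le_left _ _).trans (by norm_num), lt_min (mul_pos hσ hκ) hκ'⟩

end Summit.QuantumFields.YangMills.Theorems.QuantitativeLaplace

end
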